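import Literature.IUT.HodgeArakelov.StableCurveAgreementPiDictionary
import Literature.IUT.HodgeArakelov.LabelClassesOfCuspsCor24iOfSpecialFibre
import Literature.IUT.HodgeArakelov.PlusMinusTowerPiVIndex
import HarnessLib

/-!
# [IUTchII] Cor 2.4 (i) at an agreement with a special-fibre datum: the Δ-dictionary input `hDic` DISCHARGED at `Π_{v▶} := Π_v ∩ Π^tp_{X,ℍ'}`

S. Mochizuki, *Inter-universal Teichmüller Theory II*, kurims manuscript (Dec. 2020), §2, Def 2.3 (i) p. 67 («`Π^±_{v▶} := N_{Π^±_v}(Π_{v▶})` …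
[cf. [IUTchI], Corollary 2.3, (iv)]»), Cor 2.4 (i) pp. 69–71; *Inter-universal Teichmüller Theory I* (May 2020), §2, Cor 2.3 (iii)(iv)(v) pp. 47–48
[cite: Mochizuki2012, II Def 2.3 (i) p.67, II Cor 2.4 (i) pp.69–71; I Cor 2.3 (iii)(iv)(v) pp.47–48] (D-0012 claim key, status disputed; every printed
statement of the series is a HYPOTHESIS named by the tree's L5 predicates — nothing of the series is asserted).  abc-iut cell, seat abc-iut-w5-d132
(gen 5); node **IUTchII:Cor2.4(i)** (CONE-BOARD claimant abc-iut-w4-d012), by-name follow-up to abc-iut-w4-d012's `cor24_i_ofSpecialFibre`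
(p437194) and this seat's `StableCurveAgreement.subgraphDictionary_comap` (p437206).  PROOF-ONLY (no `def`, no `structure`, no `instance`).

THE POINT.  abc-iut-w4-d012's `StableCurveAgreement.cor24_i_ofSpecialFibre` proves the landed predicate `Cor24_i W Cu H I` at an agreement with
abc-iut-L5's datum `ofSpecialFibre X d Sf …` for an ARBITRARY `Π_{v□} = H ⊆ Π_v`, taking as a HYPOTHESIS `hDic` — «`eHat` carries `Δ^±_{v□}` onto
`Δ^tp_{X,ℍ'}`» for some sub-graph `ℍ'` (the RE-GRAPHED datum `ofSpecialFibre X d Sf … TpH' HatH' hle' cMH'`).  For the decomposition subgroup CUT OUT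
BY THAT DATUM, `H▶' := incl⁻¹(φ⁻¹ Π^tp_{X,ℍ'})` («`Π_{v▶} := Π_v ∩ Π^tp_{X,ℍ'}`», `φ` the identification `Π^tp_{X_v}(P) ⥲ Π^tp_X` underlying `eHat`),
`hDic` is NOT a hypothesis: it is this seat's THEOREM `subgraphDictionary_comap` (Def 2.3 (i) «[cf. [IUTchI], Corollary 2.3, (iv)]» as the
group-theory lemma `IsCommensurablyTerminal.normalizer_inf_eq_of_normal`, then [IUTchI] Cor 2.3 (iii)), modulo ONLY the L5 nodes [IUTchI]
Cor 2.3 (iii), (iv) of the re-graphed datum (under its `Cor23Hyp`) and `Π_v ⊴ Π^±_v` of finite index (theorems at the genuine settings).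

* **`StableCurveAgreement.cor24_i_ofSpecialFibre_comap`** — `Cor24_i W Cu H▶' I` from: [IUTchI] Prop 2.4 (i) of the datum (`h24i`); for the
  sub-graph `ℍ'`: `Π̂_{ℍ'}` = closure of `Π^tp_{ℍ'}` (`hH'`), [IUTchI] Cor 2.3 (iii), (iv), (v) of its datum (`h23iii'`, `h23iv'`, `h23v'` under
  `hHyp'`); `T.incl.range` normal of finite index; and the open-subgroup step (B) `h23vi` (GAP-LEDGER G-w4d012-2) — NO dictionary hypothesis.

HONEST LABEL: the residual of node IUTchII:Cor2.4(i) at such an agreement, FOR `Π_{v□} := H▶'`, is thereby a list of L5 NODES + (B); for the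
printed family `□ ∈ {▶} ∪ {•t}` (abc-iut-L6-t1's `SubgraphDecomposition.Ptri` / `Pbullet t`, decl of record `Cor24_i'`) one still needs
«`Π_{v□} = H▶'(ℍ_□)`» — the MERGE identification of plan/L6/MERGE-MAP.md, NOT claimed here.  Nothing of the series is asserted; no side
taken on [IUTchIII] Cor 3.12.
-/

noncomputable section

namespace Literature.IUT.HodgeArakelov

open Literature.AnabelianGeometry.EtaleTheta Literature.AnabelianGeometry.SemiGraphs Literature.IUT.HodgeTheaters
open scoped Pointwise

namespace PlusMinusTower

namespace StableCurveAgreement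

variable {S : BadPlaceSetting.{0}} {P : TopGroup.{0}} {T : TemperedCoverings S P} {W : PlusMinusTower T}
  {Cu : CuspidalInertiaData W}
  {p : ℕ} [Fact p.Prime] {X : TemperedCurve p} {d : X.GroupLevelData}
  {Sf : SpecialFibreData (X.toTemperedArithmeticGroup d)} {h36 : Sf.Gc.Prop36Hypotheses}
  {Sigma SigmaHat : Set ℕ} {hsub : Sigma ⊆ SigmaHat} {hne : Sigma.Nonempty}
  {hprime : ∀ q ∈ SigmaHat, q.Prime} {hp : p ∉ Sigma} {TpH : Subgroup Sf.chart.G}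
  {HatH : Subgroup (TemperedGraphGroupData.exists_completion_of_prop36 Sf.Gc h36 Sf.chart).choose}
  {hle : TpH.map (TemperedGraphGroupData.exists_completion_of_prop36 Sf.Gc h36
    Sf.chart).choose_spec.choose.toMonoidHom ≤ HatH}
  {cMH : {x : X.Pt // X.IsCusp x} → Prop}

/-- **IUTchII:Def2.3(i)** (kurims p.67) **The Δ-dictionary identity `hDic` of abc-iut-w4-d012's `cor24_i_ofSpecialFibre` IS A THEOREM at `H▶'`.**
At an agreement `A` with the datum `ofSpecialFibre X d Sf … TpH …` whose `eHat` is bicontinuous and restricts on `Π^±_v` to `φ` (`eHat ∘ emb = ιX ∘ φ`),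
for ANY re-graphing sub-graph `Π^tp_{ℍ'} = TpH'` (datum `D'`): `eHat` carries `Δ^±_{v▶'}` onto `Δ^tp_{X,ℍ'} ↪ Δ̂_X ⊆ Π̂_X` for
`H▶' := incl⁻¹(φ⁻¹ Π^tp_{X,ℍ'})`, modulo [IUTchI] Cor 2.3 (iii), (iv) of `D'` (under `Cor23Hyp`) and `Π_v ⊴ Π^±_v` of finite index.  PROVED
(`subgraphDictionary_comap` over the definitional re-graphing of `A`). [claim: Mochizuki2012, status: disputed] -/
theorem deltaPmBox_comap_eq_ofSpecialFibre
    (A : StableCurveAgreement W Cu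
      (StableCurveTemperedData.ofSpecialFibre X d Sf h36 Sigma SigmaHat hsub hne hprime hp TpH HatH hle cMH))
    (hA : IsHomeomorph A.eHat)
    (φ : T.Xplain ≃* (StableCurveTemperedData.ofSpecialFibre X d Sf h36 Sigma SigmaHat hsub hne hprime hp TpH HatH hle cMH).PiTp)
    (hφ : ∀ x : T.Xplain, A.eHat ⟨W.emb x, W.emb_le_pmHat ⟨x, rfl⟩⟩ =
      (StableCurveTemperedData.ofSpecialFibre X d Sf h36 Sigma SigmaHat hsub hne hprime hp TpH HatH hle cMH).ιX (φ x))
    (hN : T.incl.range.Normal) (hI : T.incl.range.index ≠ 0)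
    (TpH' : Subgroup Sf.chart.G)
    (HatH' : Subgroup (TemperedGraphGroupData.exists_completion_of_prop36 Sf.Gc h36 Sf.chart).choose)
    (hle' : TpH'.map (TemperedGraphGroupData.exists_completion_of_prop36 Sf.Gc h36
      Sf.chart).choose_spec.choose.toMonoidHom ≤ HatH')
    (cMH' : {x : X.Pt // X.IsCusp x} → Prop)
    (hHyp' : (StableCurveTemperedData.ofSpecialFibre X d Sf h36 Sigma SigmaHat hsub hne hprime hp TpH' HatH' hle' cMH').Cor23Hyp)
    (h23iii' : (StableCurveTemperedData.ofSpecialFibre X d Sf h36 Sigma SigmaHat hsub hne hprime hp TpH' HatH' hle' cMH').Cor23iii)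
    (h23iv' : (StableCurveTemperedData.ofSpecialFibre X d Sf h36 Sigma SigmaHat hsub hne hprime hp TpH' HatH' hle' cMH').Cor23iv) :
    ((W.deltaPmBox (((StableCurveTemperedData.ofSpecialFibre X d Sf h36 Sigma SigmaHat hsub hne hprime hp TpH' HatH' hle'
        cMH').piTpXH.comap φ.toMonoidHom).comap T.incl)).subgroupOf W.pmHat).map A.eHat.toMonoidHom =
      ((StableCurveTemperedData.ofSpecialFibre X d Sf h36 Sigma SigmaHat hsub hne hprime hp TpH' HatH' hle' cMH').deltaTpH.map
        (StableCurveTemperedData.ofSpecialFibre X d Sf h36 Sigma SigmaHat hsub hne hprime hp TpH' HatH' hle' cMH').ιΔ).map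
        (StableCurveTemperedData.ofSpecialFibre X d Sf h36 Sigma SigmaHat hsub hne hprime hp TpH' HatH' hle' cMH').DeltaHat.subtype :=
  (subgraphDictionary_comap
    (D := StableCurveTemperedData.ofSpecialFibre X d Sf h36 Sigma SigmaHat hsub hne hprime hp TpH' HatH' hle' cMH')
    { eHat := A.eHat, map_piPM := A.map_piPM, mem_ker_iff := A.mem_ker_iff, inertia_iff := A.inertia_iff }
    hA φ hφ hN hI hHyp' h23iii' h23iv').deltaPmBox_eq

/-- **[IUTchII] Cor 2.4 (i) (the landed predicate `Cor24_i W Cu H▶' I`) at an agreement with a special-fibre datum, WITHOUT the dictionary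
hypothesis.**  For a `Π_v`-cuspidal `I ⊆ Δ̂^cor_v` and, for a sub-graph `ℍ'` of the special fibre, the decomposition subgroup
`H▶' := incl⁻¹(φ⁻¹ Π^tp_{X,ℍ'})` («`Π_{v▶} := Π_v ∩ Π^tp_{X,ℍ'}`»): `Cor24_i W Cu H▶' I` from [IUTchI] Prop 2.4 (i) of the datum (`h24i`, input (A) via
abc-iut-w4-d012's `inputA_ofSpecialFibre`), `Π̂_{ℍ'}` = closure of `Π^tp_{ℍ'}` (`hH'`; Cor 2.3 (ii) is abc-iut-L5-t11's theorem), [IUTchI] Cor 2.3 (iii),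
(iv), (v) of the `ℍ'`-datum under its `Cor23Hyp` (`h23iii'`, `h23iv'`, `h23v'`, `hHyp'` — L5 nodes, BY NAME), `Π_v ⊴ Π^±_v` of finite index
(`hN`, `hI`; abc-iut-L6-t19's `index_piV_subgroupOf_piPM`), and the open-subgroup step (B) `h23vi` (GAP-LEDGER G-w4d012-2).  The Δ-dictionary input `hDic` of `cor24_i_ofSpecialFibre`
is DISCHARGED (`deltaPmBox_comap_eq_ofSpecialFibre`).  PROVED. ([IUTchII] Cor 2.4 (i), kurims pp.69–71) [claim: Mochizuki2012, status: disputed] -/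
theorem cor24_i_ofSpecialFibre_comap
    (hlev : ∀ (Q I : Subgroup W.Corhat), Cu.IsCuspidalInertia Q I ↔
      I ≤ Q ∧ ∃ I₀ : Subgroup W.Corhat, Cu.IsCuspidalInertia W.piPM I₀ ∧ I = I₀ ⊓ Q)
    (A : StableCurveAgreement W Cu
      (StableCurveTemperedData.ofSpecialFibre X d Sf h36 Sigma SigmaHat hsub hne hprime hp TpH HatH hle cMH))
    (hA : IsHomeomorph A.eHat)
    (φ : T.Xplain ≃* (StableCurveTemperedData.ofSpecialFibre X d Sf h36 Sigma SigmaHat hsub hne hprime hp TpH HatH hle cMH).PiTp)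
    (hφ : ∀ x : T.Xplain, A.eHat ⟨W.emb x, W.emb_le_pmHat ⟨x, rfl⟩⟩ =
      (StableCurveTemperedData.ofSpecialFibre X d Sf h36 Sigma SigmaHat hsub hne hprime hp TpH HatH hle cMH).ιX (φ x))
    (hN : T.incl.range.Normal) (hI : T.incl.range.index ≠ 0)
    (h24i : (StableCurveTemperedData.ofSpecialFibre X d Sf h36 Sigma SigmaHat hsub hne hprime hp TpH HatH hle cMH).Prop24i)
    {I : Subgroup W.Corhat} (hIc : Cu.IsCuspidalInertia W.piV I) (hIker : I ≤ W.aug.ker)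
    (TpH' : Subgroup Sf.chart.G)
    (HatH' : Subgroup (TemperedGraphGroupData.exists_completion_of_prop36 Sf.Gc h36 Sf.chart).choose)
    (hle' : TpH'.map (TemperedGraphGroupData.exists_completion_of_prop36 Sf.Gc h36
      Sf.chart).choose_spec.choose.toMonoidHom ≤ HatH')
    (cMH' : {x : X.Pt // X.IsCusp x} → Prop)
    (hH' : ((StableCurveTemperedData.ofSpecialFibre X d Sf h36 Sigma SigmaHat hsub hne hprime hp TpH' HatH' hle' cMH').graph.HatH :
        Set (StableCurveTemperedData.ofSpecialFibre X d Sf h36 Sigma SigmaHat hsub hne hprime hp TpH' HatH' hle' cMH').graph.Hat) =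
      closure ((StableCurveTemperedData.ofSpecialFibre X d Sf h36 Sigma SigmaHat hsub hne hprime hp TpH' HatH' hle' cMH').graph.ι ''
        (StableCurveTemperedData.ofSpecialFibre X d Sf h36 Sigma SigmaHat hsub hne hprime hp TpH' HatH' hle' cMH').graph.TpH))
    (hHyp' : (StableCurveTemperedData.ofSpecialFibre X d Sf h36 Sigma SigmaHat hsub hne hprime hp TpH' HatH' hle' cMH').Cor23Hyp)
    (h23iii' : (StableCurveTemperedData.ofSpecialFibre X d Sf h36 Sigma SigmaHat hsub hne hprime hp TpH' HatH' hle' cMH').Cor23iii)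
    (h23iv' : (StableCurveTemperedData.ofSpecialFibre X d Sf h36 Sigma SigmaHat hsub hne hprime hp TpH' HatH' hle' cMH').Cor23iv)
    (h23v' : (StableCurveTemperedData.ofSpecialFibre X d Sf h36 Sigma SigmaHat hsub hne hprime hp TpH' HatH' hle' cMH').Cor23v)
    (h23vi : ∀ γ' : W.Corhat, γ' ∈ W.piPM ⊓ W.aug.ker →
      I.map (MulAut.conj γ').toMonoidHom ≤
          W.pmBox (((StableCurveTemperedData.ofSpecialFibre X d Sf h36 Sigma SigmaHat hsub hne hprime hp TpH' HatH' hle'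
            cMH').piTpXH.comap φ.toMonoidHom).comap T.incl) →
        γ' ∈ closure (W.deltaPmBox (((StableCurveTemperedData.ofSpecialFibre X d Sf h36 Sigma SigmaHat hsub hne hprime hp TpH'
          HatH' hle' cMH').piTpXH.comap φ.toMonoidHom).comap T.incl) : Set W.Corhat)) :
    Literature.IUT.HodgeArakelov.Cor24_i W Cu
      (((StableCurveTemperedData.ofSpecialFibre X d Sf h36 Sigma SigmaHat hsub hne hprime hp TpH' HatH' hle'
        cMH').piTpXH.comap φ.toMonoidHom).comap T.incl) I :=
  A.cor24_i_ofSpecialFibre (by rw [W.index_piV_subgroupOf_piPM]; exact hI) hlev hA h24i hIc hIker TpH' HatH' hle' cMH' hH'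
    (A.deltaPmBox_comap_eq_ofSpecialFibre hA φ hφ hN hI TpH' HatH' hle' cMH' hHyp' h23iii' h23iv') h23v' h23vi

end StableCurveAgreement

end PlusMinusTower

end Literature.IUT.HodgeArakelov

end
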